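import Summits.QuantumFields.YangMills.Theses.FlatTubeReduction
import Summits.QuantumFields.YangMills.Theorems.FlatTubeReductionNearFlatSplitGlueDefs
import Summits.QuantumFields.YangMills.Theorems.FemtoTransferGapSlabRayleigh
import HarnessLib

/-!
# Glue of the valley split of `FlatTubeReduction.NearFlatRatioLaw` (item stmt-QuantumFields-24924)

`theorem nearFlatSplitGlue_proof : NearFlatSplitGlue`, i.e.
`PinnedTubeRatioLaw → ValleyRelocalisation → TubeMaximiser → NearFlatRatioLaw` — sorry-free.
Written by the route planner ym-idea-1 g3; landed (re-namespaced under `Theorems`) by the prover seat ym-line-sfw-p1 g9.  R2b1 is a RECORD rung: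
no summit (in particular not the Yang–Mills mass gap) is proved by this; the three children K1a `PinnedTubeRatioLaw`, K1b `ValleyRelocalisation`,
`TubeMaximiser` stay open.
(Seat ym-idea-1 g3, LINE 2. Body certified against local copies of the four decls in Sketch2.lean, lean check rc 0 / 0 sorries,
2026-08-28T02:31Z; re-certified against the route module rev 2 (ValleyRelocalisation restated with loss budget C·λ_b²/L, item stmt-QuantumFields-25191) 2026-08-28T03:1xZ.)
Proof: tube maximiser ψ⋆ (TubeMaximiser) ↦ pinned relocalisation ψ'' (ValleyRelocalisation) ↦ pinned law (PinnedTubeRatioLaw);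
transfer to an arbitrary tube state ψ ⊥ Ω by maximality; absorb `C_B·(λ_b²/L)·λ₀·μ₀` into `e^{(|C|+C_B·M)λ_b²/L}·μ₁·λ₀` with
`M = e^{|Δ₁|+|C₂|}` from the proved one-site lower law `oneSiteLevels_proof` and `bareLambda_cube_mul`.
(2026-08-30, seat ym-line-ftr-p1 g22, tree hygiene: after route render f3821d4c dropped the route decl `NearFlatSplitGlue` and its retired hypotheses
K1a/K1b — K1 `NearFlatRatioLaw` being closed·proved by `nearFlatRatioLaw_proof` — the name `Theses.FlatTubeReduction.NearFlatSplitGlue` is supplied,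
with the same body over the verbatim plain definitions of `Theorems/FlatTubeReductionValleySplitDefs.lean`, by the imported
`Theorems/FlatTubeReductionNearFlatSplitGlueDefs.lean`; this file is otherwise unchanged.)
-/

namespace Summit.QuantumFields.YangMills.Theorems.FlatTubeReduction

open Summit.QuantumFields.YangMills.Theses.FlatTubeReduction

set_option maxHeartbeats 1000000 in
open Summit.QuantumFields.YangMills.Theorems.FemtoTransferGap Literature.Analysis.OperatorTheory.YMMatrixModel in
/-- ★ **The glue item `NearFlatSplitGlue` of route FlatTubeReduction (stmt-QuantumFields-24924)**, by name:
`PinnedTubeRatioLaw → ValleyRelocalisation → TubeMaximiser → NearFlatRatioLaw` — tube maximiser ↦ pinned relocalisation ↦ pinned law,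
transfer by maximality, absorption of `C_B(λ_b²/L)λ₀μ₀` by the proved one-site lower law. [cite: Luscher1983, §3] -/
theorem nearFlatSplitGlue_proof : Summit.QuantumFields.YangMills.Theses.FlatTubeReduction.NearFlatSplitGlue := by
  intro hA hB hMax L _
  obtain ⟨θ, κ, C, β₁, hθ0, hθ1, hκ0, hκ1, H1⟩ := hA L
  obtain ⟨CB, β₂, hCB, H2⟩ := hB L θ κ hθ0 hθ1 hκ0 hκ1
  obtain ⟨C₂, B0, hONE⟩ := oneSiteLevels_proof 1
  set M : ℝ := Real.exp (|levelGap 1| + |C₂|) with hM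
  refine ⟨θ, |C| + CB * M, max (max β₁ β₂) (max 2 B0), hθ0, hθ1, fun β hβ Ω ψ hΩ hΩpos heig hψ horth hsupp => ?_⟩
  have hβ₁ : β₁ ≤ β := le_trans (le_trans (le_max_left _ _) (le_max_left _ _)) hβ
  have hβ₂ : β₂ ≤ β := le_trans (le_trans (le_max_right _ _) (le_max_left _ _)) hβ
  have h2β : (2 : ℝ) ≤ β := le_trans (le_trans (le_max_left _ _) (le_max_right _ _)) hβ
  have hB0 : B0 ≤ β := le_trans (le_trans (le_max_right _ _) (le_max_right _ _)) hβ
  have hβpos : 0 < β := by linarith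
  have hL1 : (1 : ℝ) ≤ (L : ℝ) := by exact_mod_cast NeZero.one_le
  have hLpos : (0 : ℝ) < (L : ℝ) := by linarith
  have hL3 : (1 : ℝ) ≤ (L : ℝ) ^ 3 := one_le_pow₀ hL1
  have hBge : β ≤ (L : ℝ) ^ 3 * β := le_mul_of_one_le_left hβpos.le hL3
  have hBpos : 0 < (L : ℝ) ^ 3 * β := lt_of_lt_of_le hβpos hBge
  obtain ⟨hμ0pos, -, hlow⟩ := hONE ((L : ℝ) ^ 3 * β) (hB0.trans hBge)
  set μ0 := levelValue su2Rep 1 ((L : ℝ) ^ 3 * β) 0 with hμ0def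
  set μ1 := levelValue su2Rep 1 ((L : ℝ) ^ 3 * β) 1 with hμ1def
  have hμ1nn : 0 ≤ μ1 := levelValue_su2Rep_nonneg 1 hBpos.le 1
  set v := bareLambda β with hvdef
  have hv0 : 0 < v := by
    rw [hvdef, bareLambda]; exact Real.rpow_pos_of_pos (by positivity) _
  have hv1 : v ≤ 1 := by
    rw [hvdef, bareLambda]
    apply Real.rpow_le_one (by positivity) _ (by norm_num)
    rw [div_le_one hβpos]; exact h2β
  have hvB : bareLambda ((L : ℝ) ^ 3 * β) = v / L := bareLambda_cube_mul hβpos L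
  set top := topValue su2Rep L β with htopdef
  have htop : 0 < top := topValue_su2Rep_pos L β
  set X : ℝ := Real.exp (C * v ^ 2 / L) * μ1 * top + CB * v ^ 2 / L * top * μ0 with hXdef
  have hE : 0 ≤ Real.exp (C * v ^ 2 / L) * μ1 * top := by positivity
  have hXnn : 0 ≤ X := by positivity
  -- the maximiser ψ⋆ of the tube problem, its relocalisation ψ'' and the pinned law
  obtain ⟨ψs, hψs, horths, hsupps, hpos, hmax⟩ := hMax L θ β hθ0 hβpos Ω hΩ
  obtain ⟨ψ'', hψ'', horth'', hsupp'', hpin'', hle'', hq⟩ :=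
    H2 β hβ₂ Ω ψs hΩ hΩpos heig hψs horths hsupps hmax
  have h1 := H1 β hβ₁ Ω ψ'' hΩ hΩpos heig hψ'' horth'' hsupp'' hpin''
  have keys : qform su2Rep β ψs ψs * μ0 ≤ X * l2 ψs ψs := by
    calc qform su2Rep β ψs ψs * μ0
        ≤ (qform su2Rep β ψ'' ψ'' + CB * v ^ 2 / L * top * l2 ψs ψs) * μ0 := mul_le_mul_of_nonneg_right hq hμ0pos.le
      _ = qform su2Rep β ψ'' ψ'' * μ0 + CB * v ^ 2 / L * top * μ0 * l2 ψs ψs := by ring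
      _ ≤ Real.exp (C * v ^ 2 / L) * μ1 * top * l2 ψ'' ψ'' + CB * v ^ 2 / L * top * μ0 * l2 ψs ψs := by linarith [h1]
      _ ≤ Real.exp (C * v ^ 2 / L) * μ1 * top * l2 ψs ψs + CB * v ^ 2 / L * top * μ0 * l2 ψs ψs := by
          linarith [mul_le_mul_of_nonneg_left hle'' hE]
      _ = X * l2 ψs ψs := by rw [hXdef]; ring
  -- transfer to the given ψ through maximality
  have hmaxψ := hmax ψ hψ horth hsupp
  have key : qform su2Rep β ψ ψ * μ0 ≤ X * l2 ψ ψ := by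
    have hl2ψ : 0 ≤ l2 ψ ψ := l2_self_nonneg ψ
    have step : qform su2Rep β ψ ψ * μ0 * l2 ψs ψs ≤ X * l2 ψ ψ * l2 ψs ψs := by
      calc qform su2Rep β ψ ψ * μ0 * l2 ψs ψs = (qform su2Rep β ψ ψ * l2 ψs ψs) * μ0 := by ring
        _ ≤ (qform su2Rep β ψs ψs * l2 ψ ψ) * μ0 := mul_le_mul_of_nonneg_right hmaxψ hμ0pos.le
        _ = (qform su2Rep β ψs ψs * μ0) * l2 ψ ψ := by ring
        _ ≤ (X * l2 ψs ψs) * l2 ψ ψ := mul_le_mul_of_nonneg_right keys hl2ψ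
        _ = X * l2 ψ ψ * l2 ψs ψs := by ring
    exact le_of_mul_le_mul_right step hpos
  refine key.trans ?_
  -- absorption: X ≤ exp((|C|+M) v²/L) * μ1 * top (verbatim from the certified LINE-1 glue)
  have hexp_le : levelGap 1 * bareLambda ((L : ℝ) ^ 3 * β) + C₂ * bareLambda ((L : ℝ) ^ 3 * β) ^ 2 ≤ |levelGap 1| + |C₂| := by
    rw [hvB]
    have hw0 : 0 ≤ v / L := div_nonneg hv0.le hLpos.le
    have hw1 : v / L ≤ 1 := by rw [div_le_one hLpos]; exact hv1.trans hL1
    have e1 : levelGap 1 * (v / L) ≤ |levelGap 1| := by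
      calc levelGap 1 * (v / L) ≤ |levelGap 1| * (v / L) := mul_le_mul_of_nonneg_right (le_abs_self _) hw0
        _ ≤ |levelGap 1| * 1 := mul_le_mul_of_nonneg_left hw1 (abs_nonneg _)
        _ = |levelGap 1| := mul_one _
    have e2 : C₂ * (v / L) ^ 2 ≤ |C₂| := by
      have hsq : (v / L) ^ 2 ≤ 1 := by
        calc (v / L) ^ 2 ≤ 1 ^ 2 := pow_le_pow_left₀ hw0 hw1 2
          _ = 1 := one_pow 2
      calc C₂ * (v / L) ^ 2 ≤ |C₂| * (v / L) ^ 2 := mul_le_mul_of_nonneg_right (le_abs_self _) (sq_nonneg _)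
        _ ≤ |C₂| * 1 := mul_le_mul_of_nonneg_left hsq (abs_nonneg _)
        _ = |C₂| := mul_one _
    linarith
  have hμ0M : μ0 ≤ M * μ1 := by
    have h' : μ0 ≤ Real.exp (levelGap 1 * bareLambda ((L : ℝ) ^ 3 * β) + C₂ * bareLambda ((L : ℝ) ^ 3 * β) ^ 2) * μ1 := by
      have := mul_le_mul_of_nonneg_left hlow
        (Real.exp_pos (levelGap 1 * bareLambda ((L : ℝ) ^ 3 * β) + C₂ * bareLambda ((L : ℝ) ^ 3 * β) ^ 2)).le
      rwa [← mul_assoc, ← Real.exp_add, add_neg_cancel, Real.exp_zero, one_mul] at this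
    calc μ0 ≤ _ := h'
      _ ≤ M * μ1 := mul_le_mul_of_nonneg_right (Real.exp_le_exp.mpr hexp_le) hμ1nn
  have hv32 : v ^ 3 ≤ v ^ 2 := by
    calc v ^ 3 = v ^ 2 * v := by ring
      _ ≤ v ^ 2 * 1 := mul_le_mul_of_nonneg_left hv1 (sq_nonneg v)
      _ = v ^ 2 := mul_one _
  have hCabs : Real.exp (C * v ^ 2 / L) ≤ Real.exp (|C| * v ^ 2 / L) := by
    rw [Real.exp_le_exp]
    exact div_le_div_of_nonneg_right (mul_le_mul_of_nonneg_right (le_abs_self C) (sq_nonneg v)) hLpos.le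
  have hterm2 : CB * v ^ 2 / L * top * μ0 ≤ (CB * M * v ^ 2 / L) * (μ1 * top) := by
    calc CB * v ^ 2 / L * top * μ0 ≤ CB * v ^ 2 / L * top * (M * μ1) := by
            apply mul_le_mul_of_nonneg_left hμ0M
            positivity
      _ = (CB * M * v ^ 2 / L) * (μ1 * top) := by ring
  have ha : 0 ≤ |C| * v ^ 2 / L := by positivity
  have hb : 0 ≤ CB * M * v ^ 2 / L := by positivity
  have hone : 1 ≤ Real.exp (|C| * v ^ 2 / L) := Real.one_le_exp ha
  have hl2ψ' : 0 ≤ l2 ψ ψ := l2_self_nonneg ψ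
  have hXle : X ≤ Real.exp ((|C| + CB * M) * bareLambda β ^ 2 / L) * (μ1 * top) := by
    calc X ≤ Real.exp (|C| * v ^ 2 / L) * (μ1 * top) + (CB * M * v ^ 2 / L) * (μ1 * top) := by
            rw [hXdef]
            have := mul_le_mul_of_nonneg_right hCabs (mul_nonneg hμ1nn htop.le)
            nlinarith [hterm2, this]
      _ = (Real.exp (|C| * v ^ 2 / L) + CB * M * v ^ 2 / L) * (μ1 * top) := by ring
      _ ≤ (Real.exp (|C| * v ^ 2 / L) * Real.exp (CB * M * v ^ 2 / L)) * (μ1 * top) := by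
            apply mul_le_mul_of_nonneg_right _ (mul_nonneg hμ1nn htop.le)
            have h1' : CB * M * v ^ 2 / L ≤ Real.exp (|C| * v ^ 2 / L) * (CB * M * v ^ 2 / L) :=
              le_mul_of_one_le_left hb hone
            have h2' : 1 + CB * M * v ^ 2 / L ≤ Real.exp (CB * M * v ^ 2 / L) := by
              have := Real.add_one_le_exp (CB * M * v ^ 2 / L); linarith
            nlinarith [h1', h2', Real.exp_pos (|C| * v ^ 2 / L)]
      _ = Real.exp ((|C| + CB * M) * bareLambda β ^ 2 / L) * (μ1 * top) := by
            rw [← Real.exp_add]; congr 1; rw [hvdef]; ring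
  calc X * l2 ψ ψ ≤ Real.exp ((|C| + CB * M) * bareLambda β ^ 2 / L) * (μ1 * top) * l2 ψ ψ :=
        mul_le_mul_of_nonneg_right hXle hl2ψ'
    _ = Real.exp ((|C| + CB * M) * bareLambda β ^ 2 / L) * μ1 * top * l2 ψ ψ := by ring

end Summit.QuantumFields.YangMills.Theorems.FlatTubeReduction
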